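import Summits.BirchSwinnertonDyer.Rank1Residual.GaloisImage.NineTorsionUnipotentWitness
import Literature.NumberTheory.GaloisCohomology.KolyvaginSystems
import Literature.NumberTheory.GaloisRepresentations.CyclotomicLevels
import Literature.NumberTheory.EllipticCurves.WeilPairingProofs
import Literature.NumberTheory.EllipticCurves.GeomPointsGaloisModule
import HarnessLib

/-!
# On an EXOTIC row Sakamoto's hypothesis (H.2) FAILS at level `9`: no `τ ∈ Γ_{ℚ(μ₉)}` has
# `E[9]/(τ − 1)E[9] ≃ ℤ/9` — level two of the Kolyvagin-system machinery is structurally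
# unavailable there, not only the adic image hypothesis (im)
# (cell `b2b-bsdres`, team n1011, row T-a5x NEGATIVE side; seat p13)

HONEST FRAMING (cell `b2b-bsdres`, run/shared/lean/b2b/bsd-rank1-residual/, verbatim in every
file): the goal of the cell is to DELETE the COMBINATION-SHAPED residual classes of the
Birch–Swinnerton-Dyer formula for ALL analytic-rank `≤ 1` elliptic curves over `ℚ` — "full BSD
formula for every rank `≤ 1` curve in class `C`" assembled STRICTLY from published theorems — so
that the rank-`≤ 1` remainder becomes exactly the CONSTRUCTION-SHAPED classes, which are TYPED
(missing-input `Prop`s), NOT attempted. This is not "finishing BSD". Team n1011 (N10/N11, the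
additive block `X4 ∧ p = 3`): research route; no claim beyond the stated classes; the label X4 and
the mark of RESIDUAL-MAP §I N11 are UNCHANGED by this file; nothing is booked. Theorems only, NO
hypothesis beyond surj(3) ∧ ¬surj(9): no definition, no named fact, nothing conditional.

## What and why

Row T-a5x reduced the EXOTIC unit case to a LEVEL-ONE certificate (p265535 / p266233) because on
EXOTIC rows (surj(3) ∧ ¬surj(9): Elkies' `9`-deficient `3`-adic image) the `3`-adic tower fails.  This
file proves the sharper NEGATIVE statement behind that design: not merely the image hypothesis (im)
(p249797 `not_bigIm_of_surj_three_of_not_surj_nine`) but Sakamoto's / Mazur–Rubin's hypothesis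
**(H.2) ITSELF FAILS at level `9`** — there is no `τ ∈ Gal(ℚ̄/ℚ(μ₉))` with `E[9]/(τ − 1)E[9] ≃ ℤ/9`.
Hence every Kolyvagin-system theorem of the [S24]/[MR04] family at levels `m ≥ 2` is INAPPLICABLE on
EXOTIC rows for a structural reason, and the level-one line (`m = 1`, whose `τ` exists from surj(3)
alone, p252385) is the only one; since the level-one dictionary's value clause carries the factor
`3^t` (`t = log₃ #E(ℚ₃)[3]`), EXOTIC rows with `E(ℚ₃)[3] ≠ 0` are beyond the present line — a located
obstruction, recorded here, not attacked.

PROOF (`not_levelTwoTau_of_surj_three_of_not_surj_nine`).  `f = τ − 1` on `M = E[9]` (order `81`,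
tree `card_torsionPoints_eq_sq_holds`), `R = im f`; `M/R ≃ ℤ/9` gives `#R = 9` (Lagrange).  `R` is
not killed by `3` — else `R = M[3]` (`#M[3] ≤ #E[3] = 9`) `⊇ 3M`, and `M/R` would be killed by
`3`, unlike `ℤ/9` — so `R = ⟨r₀⟩` with `ord r₀ = 9` and `τ r₀ = n·r₀`.  Weil pairing `e = e₉`
(`exists_weilPairing_holds`, Silverman III.8.1): `e(τS, r₀) = e(S + a r₀, r₀) = e(S, r₀)`
(alternating); `τ` fixes `μ₉ ∋ e(S, r₀)`, so `e(S, r₀) = e(τS, τ r₀) = e(S, r₀)^n`; with `S₀` such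
that `e(S₀, r₀)` has order `9` (non-degeneracy at `3r₀ ≠ 0`) this forces `n ≡ 1 (mod 9)`: `τ r₀ = r₀`,
`f² = 0`.  So `τ` is UNIPOTENT on `E[9]` (`τ(τQ−Q) = τQ−Q`), moves `E[9]` (`R ≠ 0`) and is no scalar
`1 + 3m` (`R ⊄ M[3]`): n1011-p14's `towerSurj_three_of_surj_of_unipotent_nine` (p258295) then gives
`ρ̄_{E,9}` onto — contradiction.

* `NoLevelTwo.pairing_zero_left/right`, `NoLevelTwo.pairing_nsmul_left/right`,
  `NoLevelTwo.exists_nsmul_eq_zsmul` — bookkeeping for a biadditive pairing with values of finite order.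
* **`not_levelTwoTau_of_surj_three_of_not_surj_nine`** — the theorem (`9`-literal spelling).
* `not_exists_tau_levelOne_spelling_of_exotic` — the same in the `k = 1` spelling of the Sakamoto N11
  instances (`rootsOfUnityFixer ℚ (3^(1+1))`, `torsionGaloisModule ((3:ℤ)^1·3)`, `ZMod (3^(1+1))`).

References: R. Sakamoto, JTNB 36 (2024) §2 (H.2) [Sakamoto2024]; B. Mazur, K. Rubin, Mem. AMS 799
(2004) §3.5 [MazurRubin2004]; N. Elkies, arXiv:math/0612734 (2006) §1–§2 [Elkies2006]; J.-P. Serre,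
*Abelian ℓ-adic representations* IV-23 [SerreAbelianLadic1968]; J. H. Silverman, *AEC* III.8.1
[SilvermanAEC2009].
-/

noncomputable section

open scoped Classical
open WeierstrassCurve Literature.NumberTheory.EllipticCurves Literature.NumberTheory.GaloisRepresentations
  Literature.NumberTheory.GaloisRepresentations.DiscreteGaloisModule Literature.NumberTheory.GaloisCohomology

namespace Summit.BirchSwinnertonDyer.Rank1Residual.GaloisImage

namespace NoLevelTwo

/-! ### Pairing bookkeeping (any biadditive pairing with values of finite order in a field) -/

variable {M K : Type*} [AddCommGroup M] [Field K]

/-- `e(0, T) = 1` for a biadditive pairing with non-zero values. [folklore] -/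
theorem pairing_zero_left (e : M → M → K) (hadd₁ : ∀ S₁ S₂ T, e (S₁ + S₂) T = e S₁ T * e S₂ T)
    (hne : ∀ S T, e S T ≠ 0) (T : M) : e 0 T = 1 := by
  have h := hadd₁ 0 0 T
  rw [add_zero] at h
  exact (mul_eq_left₀ (hne 0 T)).mp h.symm

/-- `e(S, 0) = 1`. [folklore] -/
theorem pairing_zero_right (e : M → M → K) (hadd₂ : ∀ S T₁ T₂, e S (T₁ + T₂) = e S T₁ * e S T₂)
    (hne : ∀ S T, e S T ≠ 0) (S : M) : e S 0 = 1 := by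
  have h := hadd₂ S 0 0
  rw [add_zero] at h
  exact (mul_eq_left₀ (hne S 0)).mp h.symm

/-- `e(n•S, T) = e(S, T)^n`. [folklore] -/
theorem pairing_nsmul_left (e : M → M → K) (hadd₁ : ∀ S₁ S₂ T, e (S₁ + S₂) T = e S₁ T * e S₂ T)
    (hne : ∀ S T, e S T ≠ 0) (n : ℕ) (S T : M) : e (n • S) T = e S T ^ n := by
  induction n with
  | zero => rw [zero_nsmul, pow_zero, pairing_zero_left e hadd₁ hne]
  | succ n ih => rw [succ_nsmul, hadd₁, ih, pow_succ]

/-- `e(S, n•T) = e(S, T)^n`. [folklore] -/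
theorem pairing_nsmul_right (e : M → M → K) (hadd₂ : ∀ S T₁ T₂, e S (T₁ + T₂) = e S T₁ * e S T₂)
    (hne : ∀ S T, e S T ≠ 0) (n : ℕ) (S T : M) : e S (n • T) = e S T ^ n := by
  induction n with
  | zero => rw [zero_nsmul, pow_zero, pairing_zero_right e hadd₂ hne]
  | succ n ih => rw [succ_nsmul, hadd₂, ih, pow_succ]

/-- In a group where `9 • x = 0`, every `ℤ`-multiple of `x` is an `ℕ`-multiple. [folklore] -/
theorem exists_nsmul_eq_zsmul {A : Type*} [AddCommGroup A] (x : A) (h9 : (9 : ℕ) • x = 0) (k : ℤ) :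
    ∃ n : ℕ, k • x = n • x := by
  refine ⟨(k % 9).toNat, ?_⟩
  have h9' : (9 : ℤ) • x = 0 := by rw [show (9 : ℤ) = ((9 : ℕ) : ℤ) by rfl, natCast_zsmul, h9]
  have hk : k = 9 * (k / 9) + k % 9 := by omega
  have hnn : 0 ≤ k % 9 := Int.emod_nonneg k (by norm_num)
  conv_lhs => rw [hk]
  rw [add_zsmul, mul_comm, mul_zsmul, h9', zsmul_zero, zero_add, ← natCast_zsmul,
    Int.toNat_of_nonneg hnn]

end NoLevelTwo

open NoLevelTwo

variable (W : WeierstrassCurve ℚ) [W.IsElliptic]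

/-- **(H.2) at level `9` FAILS on every EXOTIC row.**  If `ρ̄_{E,3}` is onto and `ρ̄_{E,9}` is NOT
(Elkies' `9`-deficient `3`-adic image), then there is NO `τ ∈ Gal(ℚ̄/ℚ(μ₉))` with
`E[9]/(τ − 1)E[9] ≃+ ℤ/9` — Sakamoto's hypothesis (H.2) [JTNB 36 (2024) §2] / Mazur–Rubin's
(H.2) for `(T, R) = (E[9], ℤ/9)`, i.e. the `τ`-datum of the N11 instance at `k = 1`, does not exist.
PROOF.  Let `f = τ − 1` on `M = E[9]` (order `81`) and `R = im f`, so `M/R ≃ ℤ/9` and `#R = 9`.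
`R` is not killed by `3` (else `R = M[3] ⊇ 3M` and `M/R` would be killed by `3`), so `R = ⟨r₀⟩` with
`r₀` of order `9`, and `τ r₀ = n·r₀`.  With the Weil pairing `e₉` (tree theorem
`exists_weilPairing_holds`): `e(τS, r₀) = e(S + a r₀, r₀) = e(S, r₀)` (alternating), and since `τ`
fixes `μ₉`, `e(S, r₀) = τ·e(S, r₀) = e(τS, τ r₀) = e(S, r₀)^n`; choosing `S₀` with `e(S₀, r₀)` of
order `9` (non-degeneracy at `3r₀ ≠ 0`) gives `n ≡ 1 (mod 9)`, i.e. `τ r₀ = r₀`, hence `f² = 0`: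
`τ` is a UNIPOTENT element moving `E[9]` and not a scalar — n1011-p14's
`towerSurj_three_of_surj_of_unipotent_nine` then forces `ρ̄_{E,9}` onto, contradiction.  CONSEQUENCE
for the crux: on EXOTIC rows the Kolyvagin-system theorems are unavailable at every level `m ≥ 2`
for a STRUCTURAL reason (no admissible `τ`), not only because (im) fails (p249797
`not_bigIm_of_surj_three_of_not_surj_nine`); only level one (`m = 1`, p252385) remains — and there the
dictionary's value clause carries the factor `3^t`, so rows with `E(ℚ₃)[3] ≠ 0` are out of reach of
the present line.  Nothing booked; no mark / label changed.
[cite: Sakamoto2024, §2 hypothesis (H.2) (p. 921)] [cite: Elkies2006, §1–§2]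
[cite: SilvermanAEC2009, Prop. III.8.1] -/
theorem not_levelTwoTau_of_surj_three_of_not_surj_nine
    (hsurj : W.HasSurjectiveModNGaloisRep 3) (hnot : ¬ W.HasSurjectiveModNGaloisRep 9)
    (τ : Field.absoluteGaloisGroup ℚ) (hτμ : τ ∈ rootsOfUnityFixer ℚ 9)
    (hτq : Nonempty (cokerSubOne (W.torsionGaloisModule 9) τ ≃+ ZMod 9)) : False := by
  obtain ⟨eqv⟩ := hτq
  -- `f = τ - 1` on `M = E[9]`, `R = im f`
  obtain ⟨f, hfdef⟩ : ∃ f : ↥(geomTorsion W 9) →+ ↥(geomTorsion W 9),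
      f = ((W.torsionGaloisModule 9) τ).toAddMonoidHom - AddMonoidHom.id _ := ⟨_, rfl⟩
  have eqv' : (↥(geomTorsion W 9) ⧸ f.range) ≃+ ZMod 9 := by rw [hfdef]; exact eqv
  have hf : ∀ x : geomTorsion W 9, f x = τ • x - x := fun x => by rw [hfdef]; rfl
  have hfcoe : ∀ x : geomTorsion W 9, ((f x : geomTorsion W 9) : geomPoints W) =
      τ • (x : geomPoints W) - x := fun x => by
    rw [hf, AddSubgroupClass.coe_sub, AddSubgroup.torsionBy.coe_smul]
  -- orders: `#M = 81`, `#(M/R) = 9`, `#R = 9`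
  have hM : Nat.card (geomTorsion W 9) = 81 := by
    have h := card_torsionPoints_eq_sq_holds W (AlgebraicClosure ℚ) (n := 9) (by norm_num)
    exact h
  haveI : Finite (geomTorsion W 9) := Nat.finite_of_card_ne_zero (by rw [hM]; norm_num)
  have hQ : Nat.card (↥(geomTorsion W 9) ⧸ f.range) = 9 := by
    rw [Nat.card_congr eqv'.toEquiv, Nat.card_zmod]
  have hR : Nat.card f.range = 9 := by
    have h := AddSubgroup.card_eq_card_quotient_mul_card_addSubgroup f.range
    rw [hM, hQ] at h
    omega
  -- every element of `M` is killed by `9`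
  have h9 : ∀ x : geomTorsion W 9, (9 : ℕ) • x = 0 := fun x => by
    apply Subtype.ext
    rw [AddSubmonoidClass.coe_nsmul, ZeroMemClass.coe_zero, ← natCast_zsmul]
    exact (Submodule.mem_torsionBy_iff _ _).mp x.2
  -- `R` is not killed by `3`
  have hR3 : ∃ r ∈ f.range, (3 : ℕ) • r ≠ 0 := by
    by_contra hcon
    push Not at hcon
    -- then `R ≤ M[3]`, which has at most `9` elements (it injects into `E[3]`), so `R = M[3] ⊇ 3M`
    let K3 : AddSubgroup (geomTorsion W 9) :=
      { carrier := {x | (3 : ℕ) • x = 0}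
        zero_mem' := smul_zero _
        add_mem' := fun {a b} ha hb => by
          simp only [Set.mem_setOf_eq] at ha hb ⊢
          rw [smul_add, ha, hb, add_zero]
        neg_mem' := fun {a} ha => by
          simp only [Set.mem_setOf_eq] at ha ⊢
          rw [smul_neg, ha, neg_zero] }
    have hK3mem : ∀ x : geomTorsion W 9, x ∈ K3 ↔ (3 : ℕ) • x = 0 := fun x => Iff.rfl
    have hRle : f.range ≤ K3 := fun r hr => (hK3mem r).mpr (hcon r hr)
    have hE3 : Nat.card (geomTorsion W 3) = 9 := by
      have h := card_torsionPoints_eq_sq_holds W (AlgebraicClosure ℚ) (n := 3) (by norm_num)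
      exact h
    haveI : Finite (geomTorsion W 3) := Nat.finite_of_card_ne_zero (by rw [hE3]; norm_num)
    have hK3card : Nat.card K3 ≤ 9 := by
      rw [← hE3]
      refine Nat.card_le_card_of_injective
        (fun x : K3 => (⟨((x : geomTorsion W 9) : geomPoints W), ?_⟩ : geomTorsion W 3)) ?_
      · have hx : (3 : ℕ) • (x : geomTorsion W 9) = 0 := (hK3mem _).mp x.2
        have hx' := congrArg (fun y : geomTorsion W 9 => (y : geomPoints W)) hx
        simp only [AddSubmonoidClass.coe_nsmul, ZeroMemClass.coe_zero] at hx'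
        refine (Submodule.mem_torsionBy_iff _ _).mpr ?_
        rw [show (3 : ℤ) = ((3 : ℕ) : ℤ) by rfl, natCast_zsmul]
        exact hx'
      · intro x y hxy
        have h := congrArg (fun z : geomTorsion W 3 => (z : geomPoints W)) hxy
        exact Subtype.ext (Subtype.ext h)
    have hReq : f.range = K3 := AddSubgroup.eq_of_le_of_card_ge hRle (by rw [hR]; exact hK3card)
    have h3M : ∀ m : geomTorsion W 9, (3 : ℕ) • m ∈ f.range := fun m => by
      rw [hReq, hK3mem, smul_smul]
      exact h9 m
    have hquot : ∀ z : ↥(geomTorsion W 9) ⧸ f.range, (3 : ℕ) • z = 0 := by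
      intro z
      induction z using QuotientAddGroup.induction_on with
      | H m =>
        rw [← QuotientAddGroup.mk_nsmul, QuotientAddGroup.eq_zero_iff]
        exact h3M m
    have h31 : (3 : ℕ) • (1 : ZMod 9) = 0 := by
      rw [← eqv'.apply_symm_apply 1, ← map_nsmul, hquot, map_zero]
    exact absurd h31 (by decide)
  obtain ⟨r₀, hr₀R, hr₀3⟩ := hR3
  -- `r₀` has order `9`, so `R = ⟨r₀⟩`
  have hord : addOrderOf r₀ = 9 := by
    have h := addOrderOf_eq_prime_pow (p := 3) (n := 1) (x := r₀)
      (by rw [pow_one]; exact hr₀3) (by rw [show (3 ^ (1 + 1) : ℕ) = 9 by norm_num]; exact h9 r₀)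
    rw [h]; norm_num
  have hRgen : f.range = AddSubgroup.zmultiples r₀ := by
    refine (AddSubgroup.eq_of_le_of_card_ge (AddSubgroup.zmultiples_le.mpr hr₀R) ?_).symm
    rw [hR, Nat.card_zmultiples, hord]
  have hmul : ∀ x : geomTorsion W 9, ∃ a : ℕ, f x = a • r₀ := fun x => by
    have hx : f x ∈ AddSubgroup.zmultiples r₀ := hRgen ▸ AddMonoidHom.mem_range.mpr ⟨x, rfl⟩
    obtain ⟨k, hk⟩ := AddSubgroup.mem_zmultiples_iff.mp hx
    obtain ⟨a, ha⟩ := exists_nsmul_eq_zsmul r₀ (h9 r₀) k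
    exact ⟨a, by rw [← hk, ha]⟩
  -- `τ r₀ = n₁ • r₀`
  obtain ⟨n₁, hn₁⟩ : ∃ n₁ : ℕ, τ • r₀ = n₁ • r₀ := by
    obtain ⟨a, ha⟩ := hmul r₀
    refine ⟨a + 1, ?_⟩
    have h := hf r₀
    rw [ha] at h
    rw [add_nsmul, one_nsmul, h, sub_add_cancel]
  -- the Weil pairing on `E[9]`
  obtain ⟨e, hμ, hadd₁, hadd₂, halt, hnd, hgal⟩ :=
    exists_weilPairing_holds W 9 (by norm_num) (by norm_num)
  have hne : ∀ S T, e S T ≠ 0 := fun S T h0 => by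
    have h := hμ S T
    rw [h0, zero_pow (by norm_num)] at h
    exact zero_ne_one h
  -- `e(τ S, r₀) = e(S, r₀)`
  have hτS : ∀ S : geomTorsion W 9, τ • S = S + f S := fun S => by rw [hf, add_sub_cancel]
  have hG : ∀ S : geomTorsion W 9, e (τ • S) r₀ = e S r₀ := fun S => by
    obtain ⟨a, ha⟩ := hmul S
    rw [hτS, hadd₁, ha, pairing_nsmul_left e hadd₁ hne, halt, one_pow, mul_one]
  -- `e(S, r₀)^{n₁} = e(S, r₀)` for every `S`
  have hH : ∀ S : geomTorsion W 9, e S r₀ ^ n₁ = e S r₀ := fun S => by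
    have hfix : τ • e S r₀ = e S r₀ := mem_rootsOfUnityFixer_iff.mp hτμ (e S r₀) (hμ S r₀)
    rw [hgal, hn₁, pairing_nsmul_right e hadd₂ hne, hG] at hfix
    exact hfix
  -- some `e(S₀, r₀)` has order `9`
  have h3r₀ : (3 : ℕ) • r₀ ≠ 0 := hr₀3
  obtain ⟨S₀, hS₀⟩ : ∃ S₀ : geomTorsion W 9, e S₀ r₀ ^ 3 ≠ 1 := by
    by_contra hcon
    push Not at hcon
    exact h3r₀ (hnd _ fun S => by rw [pairing_nsmul_right e hadd₂ hne, hcon S])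
  have hordζ : orderOf (e S₀ r₀) = 9 := by
    have h := orderOf_eq_prime_pow (p := 3) (n := 1) (x := e S₀ r₀)
      (by rw [pow_one]; exact hS₀) (by rw [show (3 ^ (1 + 1) : ℕ) = 9 by norm_num]; exact hμ S₀ r₀)
    rw [h]; norm_num
  have hn₁mod : n₁ % 9 = 1 := by
    have h := hH S₀
    have hn₁pos : n₁ ≠ 0 := by
      rintro rfl
      apply hS₀
      rw [pow_zero] at h
      rw [← h, one_pow]
    obtain ⟨m, rfl⟩ := Nat.exists_eq_succ_of_ne_zero hn₁pos
    have hm : e S₀ r₀ ^ m = 1 := by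
      rw [pow_succ] at h
      exact (mul_eq_right₀ (hne S₀ r₀)).mp h
    have hdvd : 9 ∣ m := hordζ ▸ orderOf_dvd_of_pow_eq_one hm
    omega
  -- hence `τ r₀ = r₀` and `f² = 0`
  have hτr₀ : τ • r₀ = r₀ := by
    rw [hn₁, ← mod_addOrderOf_nsmul, hord, hn₁mod, one_nsmul]
  have hfr₀ : f r₀ = 0 := by rw [hf, hτr₀, sub_self]
  have hff : ∀ x : geomTorsion W 9, f (f x) = 0 := fun x => by
    obtain ⟨a, ha⟩ := hmul x
    rw [ha, map_nsmul, hfr₀, smul_zero]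
  -- `τ` is a unipotent, non-trivial, non-scalar element on `E[9]`: p14's tower criterion fires
  have hU : ∀ Q ∈ geomTorsion W 9, τ • (τ • Q - Q) = τ • Q - Q := by
    intro Q hQ
    have h1 : τ • Q - Q = ((f ⟨Q, hQ⟩ : geomTorsion W 9) : geomPoints W) := by rw [hfcoe]
    have h2 := hfcoe (f ⟨Q, hQ⟩)
    rw [hff, ZeroMemClass.coe_zero] at h2
    rw [h1]
    exact (sub_eq_zero.mp h2.symm)
  have hMv : ∃ Q ∈ geomTorsion W 9, τ • Q ≠ Q := by
    by_contra hcon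
    push Not at hcon
    have hf0 : ∀ x : geomTorsion W 9, f x = 0 := fun x => by
      apply Subtype.ext
      rw [hfcoe, hcon x x.2, sub_self, ZeroMemClass.coe_zero]
    have hbot : f.range = ⊥ := by
      refine (AddSubgroup.eq_bot_iff_forall _).mpr fun r hr => ?_
      obtain ⟨x, rfl⟩ := AddMonoidHom.mem_range.mp hr
      exact hf0 x
    have h := hR
    rw [hbot, AddSubgroup.card_bot] at h
    exact absurd h (by norm_num)
  have hD : ∀ m : ℕ, (∀ Q ∈ geomTorsion W 9, τ • Q = (1 + 3 * m) • Q) → 3 ∣ m := by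
    intro m hm
    exfalso
    apply h3r₀
    obtain ⟨x, hx⟩ := AddMonoidHom.mem_range.mp hr₀R
    have hfx : f x = (3 * m) • x := by
      apply Subtype.ext
      rw [hfcoe, hm x x.2, AddSubmonoidClass.coe_nsmul, add_nsmul, one_nsmul, add_sub_cancel_left]
    rw [← hx, hfx, smul_smul, show 3 * (3 * m) = m * 9 by ring, mul_nsmul]
    simp [h9]
  exact hnot (by simpa using towerSurj_three_of_surj_of_unipotent_nine W hsurj τ hU hMv hD 2)


/-- **The N11 reading at `k = 1`: the `τ`-binder of the Sakamoto instances is UNSATISFIABLE on EXOTIC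
rows.**  In the spelling of `kolyvaginSystems_freeRankOne_propagatedSelmerStructure_of_surj W hS24 1 …`
(p260356) / p255331 at `k = 1` — `τ ∈ rootsOfUnityFixer ℚ (3^(1+1))`,
`cokerSubOne (W.torsionGaloisModule ((3:ℤ)^1·3)) τ ≃+ ZMod (3^(1+1))` — no such `τ` exists when
`ρ̄_{E,3}` is onto and `ρ̄_{E,9}` is not.  (At `k ≥ 2`, (H.2) at level `3^{k+1}` reduces to (H.2) at
level `9` by tensoring the free rank-one quotient with `ℤ/9` — NOT formalised here; the `k = 1`
statement is what the level-two Kurihara certificates of the cell would need.)  So on EXOTIC rows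
ONLY the level-one instance (`m = 1`, surj(3) alone) of the crux's Kolyvagin-system line is
available.  Nothing booked. [cite: Sakamoto2024, §2 hypothesis (H.2) (p. 921)] [cite: Elkies2006, §1–§2] -/
theorem not_exists_tau_levelOne_spelling_of_exotic
    (hsurj : W.HasSurjectiveModNGaloisRep 3) (hnot : ¬ W.HasSurjectiveModNGaloisRep 9) :
    ¬ ∃ τ : Field.absoluteGaloisGroup ℚ, τ ∈ rootsOfUnityFixer ℚ (3 ^ (1 + 1)) ∧
      Nonempty (cokerSubOne (W.torsionGaloisModule (((3 : ℕ) : ℤ) ^ 1 * ((3 : ℕ) : ℤ))) τ ≃+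
        ZMod (3 ^ (1 + 1))) := by
  rintro ⟨τ, hτμ, hτq⟩
  have hlevel : ((3 : ℕ) : ℤ) ^ 1 * ((3 : ℕ) : ℤ) = 9 := by norm_num
  rw [hlevel] at hτq
  exact not_levelTwoTau_of_surj_three_of_not_surj_nine W hsurj hnot τ (by simpa using hτμ)
    (by simpa using hτq)

end Summit.BirchSwinnertonDyer.Rank1Residual.GaloisImage

end
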